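import Mathlib
import Summits.AtomisticToContinuum.HydrodynamicLimit.Theorems.ImplosionDichotomyDenseExcursionPackingAnalyticDefs
import Summits.AtomisticToContinuum.HydrodynamicLimit.Theorems.ImplosionDichotomyDenseExcursionSonicCavityDefs

/-!
# Vocabulary of the line `packing-analytic-implosion`, part B (proposed reshape of `stub_analyticPackingImplosion`,
# crux `DenseExcursion`, stmt-AtomisticToContinuum-12586): the QUANTITATIVE packing-order resolvent

Definitions file (`--supports stmt-AtomisticToContinuum-12586`, line lead a2; drafted by the wave-2 worker W6 of
`stub_analyticPackingImplosion`, see `work/stubs/W6_analyticPackingImplosion.REPORT.md`). Why a part B: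

THE REGISTERED LINEAR HYPOTHESIS OF `stub_analyticPackingImplosion` IS TOO WEAK. `LargeRealResolvent r W S` (part A) is
QUALITATIVE (beyond some `Λ₀`: no smooth mode, and mere EXISTENCE of a smooth centre-regular solution of `(Λ − L)u = f`)
and says nothing at the finitely many packing orders `kμ < Λ₀`. The construction of the analytic packing implosion
`Γ = SS + Σ_k Gᵏ X_k` needs, at EVERY order `k ≥ 1`, a smooth centre-regular solution `X_k` of `(kμ − L)X_k = Src_k`
(`packingHierarchy_order`), and from some order on the LAPLACE GAIN `‖X_k‖ ≤ C‖Src_k‖/k` in a norm in which the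
sources close: the first `x`-derivatives entering `Src_{k+1}` are recovered from the first-order system itself
(`X_k′ = B⁻¹((kμ − C₀)X_k − Src_k)`, `B = [[W−1, 3S],[S/3, W−1]]`, invertible off the sonic point), which costs the
factor `kμ‖X_k‖` — bounded only thanks to the gain; without it the recursion is factorial. No abstract argument
(closed graph) makes `LargeRealResolvent` quantitative UNIFORMLY in `k`. The weighted `C⁰ → C⁰` form below is TRUE for
large `k` precisely because the sonic Frobenius exponent `ν(kμ) = (b(0) − kμ)/κ` (`b(0) = 4 − 2r − κ`,
`sonic_order_zero_coefficient`) is NEGATIVE for `kμ > b(0)` (`k ≥ 5` on the window): the smooth branch at the repulsive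
sonic point is forced, with the gain `1/|ν|` and no loss of derivatives (NUMERICS-a2 §1: ratio `≈ 0.9/Λ` near-sonic,
`≈ 5/Λ` deep-core for `5 ≤ Λ ≤ 35`); for `k ≤ 4` (`ν > 0`, loss of `⌈ν⌉` derivatives) only existence with finite norm is
asked (the seeds of the majorant induction), which `CavityResolventCk 5` delivers at `Λ = kμ` outside the residue discs.

Contents: `PackingResolvent` (+ the trivial `packingResolvent_exists_solution`). NOT here: any proof of a stub.
-/

noncomputable section

open Filter Set
open scoped Topology ContDiff

namespace Summit.AtomisticToContinuum.HydrodynamicLimit.Theorems.PackingAnalyticImplosion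

open Summit.AtomisticToContinuum.HydrodynamicLimit.Theorems.R2OneModeTwoConditions

/-- **THE PACKING-ORDER RESOLVENT** (proposed quantitative linear hypothesis of `stub_analyticPackingImplosion`,
replacing `LargeRealResolvent`). At EVERY packing order `Λ = kμ`, `k ≥ 1`, `μ = 3(r − 1)`: every smooth centre-regular
REAL source `(f₁, f₂)` (complex vocabulary by coercion, as in `LargeRealResolvent`) whose GLOBAL weighted sup
`|f₁| + |f₂|/S` is `≤ N` — weight `1` on the `w`-component and `1/S` on the `s`-component (the RELATIVE sound-speed
perturbation; `≍ eˣ|f₂|` on the core `x ≤ 1` by `CavityTube` (c), `≍ e^{rx}|f₂|` in the far field) — has a smooth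
centre-regular real solution `u = (u₁, u₂)` of `kμ u − L u = f`, `L = (linW, linS)`, with FINITE weighted sup, and from
some order `k₀` on with the LAPLACE GAIN `|u₁| + |u₂|/S ≤ C·N/k` everywhere, `C` independent of `k`. (Uniqueness among
smooth centre-regular pairs is free: `hierarchy_solution_unique`.) This is exactly what the majorant construction of `Γ`
consumes: existence at all orders, the `1/k` gain in a weighted `C⁰` norm with NO loss of derivatives for `k ≥ k₀`
(true since `ν(kμ) < 0` there), first derivatives being recovered from the first-order system off the sonic point and
from the analytic smooth branch (`CavityTube` (e)) at it. -/
def PackingResolvent (r : ℝ) (W S : ℝ → ℝ) : Prop :=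
  ∃ (k₀ : ℕ) (C : ℝ), 0 < C ∧ ∀ k : ℕ, 1 ≤ k →
    ∀ f₁ f₂ : ℝ → ℝ, IsRegularPair (fun x => (f₁ x : ℂ)) (fun x => (f₂ x : ℂ)) →
      ∀ N : ℝ, (∀ y, |f₁ y| + |f₂ y| / S y ≤ N) →
        ∃ u₁ u₂ : ℝ → ℝ, IsRegularPair (fun x => (u₁ x : ℂ)) (fun x => (u₂ x : ℂ)) ∧
          (∀ x, (((k : ℝ) * (3 * (r - 1)) : ℝ) : ℂ) * (u₁ x : ℂ) -
                linW r W S (fun y => (u₁ y : ℂ)) (fun y => (u₂ y : ℂ)) x = (f₁ x : ℂ) ∧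
               (((k : ℝ) * (3 * (r - 1)) : ℝ) : ℂ) * (u₂ x : ℂ) -
                linS r W S (fun y => (u₁ y : ℂ)) (fun y => (u₂ y : ℂ)) x = (f₂ x : ℂ)) ∧
          (∃ N' : ℝ, ∀ y, |u₁ y| + |u₂ y| / S y ≤ N') ∧
          (k₀ ≤ k → ∀ y, |u₁ y| + |u₂ y| / S y ≤ C * N / k)

/-- The existence half of `PackingResolvent` at one order, unpacked (bookkeeping for consumers). [folklore] -/
theorem packingResolvent_exists_solution : ∀ {r : ℝ} {W S : ℝ → ℝ}, PackingResolvent r W S → ∀ {k : ℕ}, 1 ≤ k → ∀ {f₁ f₂ : ℝ → ℝ}, IsRegularPair (fun x => (f₁ x : ℂ)) (fun x => (f₂ x : ℂ)) → (∃ N : ℝ, ∀ y, |f₁ y| + |f₂ y| / S y ≤ N) → ∃ u₁ u₂ : ℝ → ℝ, IsRegularPair (fun x => (u₁ x : ℂ)) (fun x => (u₂ x : ℂ)) ∧ (∀ x, (((k : ℝ) * (3 * (r - 1)) : ℝ) : ℂ) * (u₁ x : ℂ) - linW r W S (fun y => (u₁ y : ℂ)) (fun y => (u₂ y : ℂ))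 x = (f₁ x : ℂ) ∧ (((k : ℝ) * (3 * (r - 1)) : ℝ) : ℂ) * (u₂ x : ℂ) - linS r W S (fun y => (u₁ y : ℂ)) (fun y => (u₂ y : ℂ)) x = (f₂ x : ℂ)) ∧ ∃ N' : ℝ, ∀ y, |u₁ y| + |u₂ y| / S y ≤ N' := by
  intro r W S h k hk f₁ f₂ hf hN
  obtain ⟨k₀, C, -, hres⟩ := h
  obtain ⟨N, hN⟩ := hN
  obtain ⟨u₁, u₂, hu, hsol, hfin, -⟩ := hres k hk f₁ f₂ hf N hN
  exact ⟨u₁, u₂, hu, hsol, hfin⟩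

end Summit.AtomisticToContinuum.HydrodynamicLimit.Theorems.PackingAnalyticImplosion

end
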